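import Literature.AlgebraicGeometry.HodgeTheory.BettiKunnethPiecesJointActionCriteria
import Literature.AlgebraicGeometry.HodgeTheory.BettiKunnethPiecesHardLefschetzReduction
import Literature.AlgebraicGeometry.HodgeTheory.ProductFactorsHodgeDescent
import HarnessLib

/-!
# `HC(Y × Z)` for ALL smooth projective `Y` (`dim m`) and `Z` (`dim n`): `HC(Y × Z)` ⟺ `HC(Y)`, `HC(Z)` and, in each degree `2c` with `2 ≤ c`, `2c ≤ m + n`, every WINDOW family of morphisms of
# `ℚ`-Hodge structures `φ_{ij} : H^{2n−j}(Z) → Hⁱ(Y)(c − n)`, `1 ≤ i ≤ m`, `1 ≤ j ≤ n`, `i + j = 2c`, is JOINTLY induced by one rational algebraic class of `H^{2c}(Y × Z)`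
# (Voisin I §11.3.3 Thm. 11.38–11.40, Lemma 11.41, pp. 285–287; §6.2.3 Thm. 6.25, Rem. 6.27; §7.3.1 Def. 7.22, §7.3.2 Lemma 7.28; Thm. 11.30; Voisin II Prop. 9.20; Voisin 2025 §3.2.1; Arapura Lemma 4.2)

Family `hodge`, lane `lit-hodgefound` (Track 2 foundations library; Layers A1/A4), layer `Literature/AlgebraicGeometry/HodgeTheory`.  THEOREMS ONLY (no definition, no named fact, no instance;
D-0026 net debt `0`).  The general form of the seat's g31-#8 (surface × `n`-fold) and g31-#9 (threefold × `n`-fold), for two factors of ARBITRARY dimensions, and the joint (`Hom_HS`-family)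
counterpart of the tree's piece-by-piece assembly `BettiUniverse.hodgeConjectureFor_tensor_of_kunneth_pieces_pos_le`: the Künneth pieces `Hⁱ(Y) ⊗ Hʲ(Z)` of `H^{2c}(Y × Z)` outside the WINDOW
`1 ≤ i ≤ m`, `1 ≤ j ≤ n` are free — `i > 2m` or `j > 2n` vanish, `i = 0` / `j = 0` are governed by `HC(Z)` / `HC(Y)`, `m < i ≤ 2m` reduces by hard Lefschetz on `Y` (`L^{i−m} : H^{2m−i} ⥲ Hⁱ`) to the
piece `H^{2m−i}(Y) ⊗ Hʲ(Z)` of degree `2(c + m − i) < 2c`, `n < j ≤ 2n` by hard Lefschetz on `Z` to degree `2(c + n − j) < 2c` (strong induction on `c`), and total degree `≤ 2` is Lefschetz `(1,1)` — so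
(g31-#6, the joint criterion relative to a set of pieces with free complement) all Hodge classes of `Y × Z` are algebraic iff, degree by degree, every family of Hodge classes of the window pieces is
JOINTLY matched, in its actions `H^{2n−j}(Z;ℂ) → Hⁱ(Y;ℂ)`, by one algebraic class; by Lemma 11.41 with integer twists (g31-#2) the window Hodge families are exactly the window families of morphisms of
Hodge structures `φ_{ij} ∈ Hom_HS(H^{2n−j}(Z), Hⁱ(Y)(c − n))`.  The per-piece criterion needs each `crossMap t_{ij}` to be algebraic in isolation; the joint criterion is isolation-free and is an
EQUIVALENCE in the language of Hodge morphisms.  With `HC(Y × Z) ⟹ HC(Y), HC(Z)` (the projections are surjective; tree `hodgeConjectureFor_of_tensor_left/right`) the factors' conjectures move to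
the right-hand side (§3).

WHAT IS PROVED.
* §1 (any orientation family `μ`) **`BettiUniverse.tensor_forall_hodgeClasses_algebraic_of_joint_corrAction_window`** — `HC(Y)`, `HC(Z)` and the joint criterion on the window Hodge families in the
  degrees `2 ≤ c`, `2c ≤ m + n` ⇒ every Hodge class of every `H^{2c}(Y × Z)` is algebraic; **`BettiUniverse.hodgeConjectureFor_tensor_iff_forall_kunneth_window_family_exists_algebraic`** — given
  `HC(Y)`, `HC(Z)`: `HC(Y × Z)` ⟺ that joint criterion.
* §2 (complex orientations) **`BettiUniverse.hodgeConjectureFor_tensor_iff_forall_hom_window_family_exists_algebraic`** — given `HC(Y)`, `HC(Z)`: `HC(Y × Z)` ⟺ every window family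
  `(φ_{ij})`, `φ_{ij} : H^{2n−j}(Z) → Hⁱ(Y)(c − n)`, is jointly induced by a rational class `γ` of `H^{2c}(Y × Z)` with `γ ⊗ 1` algebraic.
* §3 **`BettiUniverse.hodgeConjectureFor_tensor_iff_factors_and_forall_hom_window_family_exists_algebraic`** — `HC(Y × Z)` ⟺ `HC(Y) ∧ HC(Z) ∧` the window criterion of §2.

THE PRINTS.  C. Voisin (2002) [VoisinHodgeI2002] §6.2.3 Thm. 6.25, Rem. 6.27; §7.3.1 Def. 7.22, Lemma 7.23; §7.3.2 Lemma 7.28, Rem. 7.29; §11.3.1 Thm. 11.30; §11.3.3 Thm. 11.38–11.40, Lemma 11.41 and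
pp. 285–287.  C. Voisin (2003) [VoisinHodgeII2003] §9.2.4 Prop. 9.20 (for divisors, a tree theorem).  C. Voisin (2025) [Voisin2025] §3.2.1 (12)–(14), Prop. 3.8, Cor. 3.9.  D. Arapura (2006)
[Arapura2006] §4 Lemma 4.2, §1 Cor. 1.2.  P. Deligne (2000/2006) [Deligne2000] §1.

THE OBJECTS (all the tree's).  `BettiUniverse.KunnethSrc`, `BettiUniverse.kunnethSummand`, `BettiUniverse.kunnethMap`, `BettiUniverse.crossMap`, `BettiUniverse.hodge`, `corrAction μ`,
`HodgeStructure.Hom`, `tateTwist` (`r : ℤ`), `cast`, `hodgeClasses`, `ofRatClass`, `algebraicClasses`, `HodgeConjectureFor`; the seat's g31-#6 `BettiUniverse.forall_hodgeClasses_algebraic_of_joint_corrAction`,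
`BettiUniverse.joint_corrAction_iff_joint_hom_tateTwist_int`, g31-#5 `BettiUniverse.corrAction_kunnethMap_eq`, the tree's `…ofRatClass_crossMap_mem_algebraicClasses_of_lefschetzRange/_of_lt/_of_fst_zero/
_of_snd_zero/_of_hardLefschetz_left/_of_hardLefschetz_right`, `BettiUniverse.crossMap_mem_hodgeClasses`, `BettiUniverse.kunnethMap_mem_hodgeClasses_iff`, `BettiUniverse.kunnethMap_apply`,
`hodgeConjectureFor_of_tensor_left/right`, `IsSmoothProjective.tensor_holds`, `hodgeConjectureFor_iff_of_hodgeModel`, `BettiUniverse.forall_mem_hodgeClasses_hodge_iff`.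

DEVIATIONS / SCOPE.  §1 for any orientation family; §2–§3 for complex orientations (the `Hom_HS` dictionary of g31-#2).  No definitions.

## References
* [VoisinHodgeI2002] C. Voisin, *Hodge Theory and Complex Algebraic Geometry I* (2002) — §6.2.3 Thm. 6.25, Rem. 6.27; §7.3.1 Def. 7.22, Lemma 7.23; §7.3.2 Lemma 7.28, Rem. 7.29; §11.3.1 Thm. 11.30; §11.3.3 Thm. 11.38–11.40, Lemma 11.41, pp. 285–287.
* [VoisinHodgeII2003] C. Voisin, *Hodge Theory and Complex Algebraic Geometry II* (2003) — §9.2.4 Prop. 9.20.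
* [Voisin2025] C. Voisin, *Cycle classes on algebraic varieties* (2025) — §3.2.1 (12)–(14), Prop. 3.8, Cor. 3.9.
* [Arapura2006] D. Arapura, *Motivation for Hodge cycles* (2006) — §4 Lemma 4.2, §1 Cor. 1.2.
* [Deligne2000] P. Deligne, *The Hodge conjecture* (Clay problem description) — §1.

## Provenance
Lane `lit-hodgefound` (Hodge path, Track 2), prover seat `lit-hodgefound-p29` (generation 31), self-proposed row g31-#10 (two factors of arbitrary dimensions: the window `1 ≤ i ≤ m`, `1 ≤ j ≤ n` and
the joint `Hom_HS`-family criterion in every degree).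
-/

noncomputable section

open scoped TensorProduct
open CategoryTheory MonoidalCategory CartesianMonoidalCategory Module Finset
open Literature.AlgebraicTopology.SingularHomology
open Literature.Geometry.Kaehler

namespace Literature.AlgebraicGeometry.HodgeTheory

open Literature.AlgebraicGeometry.Motives
open Literature.AlgebraicGeometry.Motives.HodgeStructure

variable {m n d : ℕ} {Y Z : SchemeOver ℂ}

section Joint

variable [HodgeTensorFacts.{0, 0}] (μ : OrientationFamily)

/-! ### §1 The window `1 ≤ i ≤ m`, `1 ≤ j ≤ n`: all degrees, by strong induction on `c` -/

/-- **Two factors of arbitrary dimensions, all degrees.**  Let `Y` (`dim m`) and `Z` (`dim n`) be smooth projective with `HC(Y)` and `HC(Z)`, and suppose that for every `c` with `2 ≤ c`, `2c ≤ m + n` and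
every family `(t_{ij})` of Hodge classes of the Künneth summands of `H^{2c}(Y × Z)` there is a rational class `γ` with `γ ⊗ 1` algebraic acting on `H^{2n−j}(Z;ℂ)` as `crossMap t_{ij} ⊗ 1` for every
window piece `1 ≤ i ≤ m`, `1 ≤ j ≤ n`.  Then EVERY Hodge class of EVERY `H^{2c}(Y × Z)` is algebraic: the complement of the window is free — `i > 2m` / `j > 2n` vanish, `i = 0` / `j = 0` are `HC(Z)` /
`HC(Y)` in degree `2c`, `m < i ≤ 2m` / `n < j ≤ 2n` reduce by hard Lefschetz on `Y` / on `Z` (`Lˢ` of a divisor class maps `N^{c₀}` into `N^c`) to degrees `< 2c` (induction), total degree `≤ 2` is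
Lefschetz `(1,1)` — and g31-#6 applies. [cite: VoisinHodgeI2002, §6.2.3 Thm. 6.25, Rem. 6.27, §11.3.1 Thm. 11.30, §11.3.3 Thm. 11.38–11.40, Lemma 11.41 and pp. 285–287] [cite: VoisinHodgeII2003, §9.2.4 Prop. 9.20]
[cite: Voisin2025, §3.2.1 (12)–(14), Prop. 3.8 and Cor. 3.9] -/
theorem BettiUniverse.tensor_forall_hodgeClasses_algebraic_of_joint_corrAction_window (hHD : exists_isReal_hodgeModel) (hY : IsSmoothProjective m Y) (hZ : IsSmoothProjective n Z)
    (hYZ : IsSmoothProjective d (Y ⊗ Z)) (hHCY : HodgeConjectureFor m Y) (hHCZ : HodgeConjectureFor n Z)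
    (hJ : ∀ c : ℕ, 2 ≤ c → 2 * c ≤ m + n → ∀ t : BettiUniverse.KunnethSrc Y Z (2 * c), (∀ ij, t ij ∈ (BettiUniverse.kunnethSummand hHD hY hZ (2 * c) ij).hodgeClasses c) →
      ∃ γ : bettiCohomology (Y ⊗ Z) (2 * c), ofRatClass (ComplexPoints (Y ⊗ Z)) (2 * c) γ ∈ algebraicClasses (Y ⊗ Z) c ∧
        ∀ (i j a : ℕ) (hij : i + j = 2 * c) (_haj : a + j = 2 * n) (hab : a + 2 * c = i + 2 * n), 1 ≤ i → i ≤ m → 1 ≤ j → j ≤ n →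
          corrAction μ hY hZ hab (ofRatClass (ComplexPoints (Y ⊗ Z)) (2 * c) γ) =
            corrAction μ hY hZ hab (ofRatClass (ComplexPoints (Y ⊗ Z)) (2 * c) (BettiUniverse.crossMap Y Z hij (t ⟨(i, j), HasAntidiagonal.mem_antidiagonal.2 hij⟩))))
    (c : ℕ) : ∀ v ∈ (BettiUniverse.hodge hHD hYZ (2 * c)).hodgeClasses c, ofRatClass (ComplexPoints (Y ⊗ Z)) (2 * c) v ∈ algebraicClasses (Y ⊗ Z) c := by
  have hI := hodgePQ_independent_of_hodgeModel_holds
  have hHCYc : ∀ c' : ℕ, ∀ y ∈ (BettiUniverse.hodge hHD hY (2 * c')).hodgeClasses c', ofRatClass (ComplexPoints Y) (2 * c') y ∈ algebraicClasses Y c' :=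
    fun c' y hy ↦ hHCY.2 c' _ (isRationalClass_ofRatClass _) ((BettiUniverse.mem_hodgeClasses_hodge_iff_isOfHodgeType hHD hY c' y).1 hy)
  have hHCZc : ∀ c' : ℕ, ∀ z ∈ (BettiUniverse.hodge hHD hZ (2 * c')).hodgeClasses c', ofRatClass (ComplexPoints Z) (2 * c') z ∈ algebraicClasses Z c' :=
    fun c' z hz ↦ hHCZ.2 c' _ (isRationalClass_ofRatClass _) ((BettiUniverse.mem_hodgeClasses_hodge_iff_isOfHodgeType hHD hZ c' z).1 hz)
  induction c using Nat.strong_induction_on with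
  | _ c IH =>
  refine BettiUniverse.forall_hodgeClasses_algebraic_of_joint_corrAction μ hHD hY hZ hYZ
    (fun j ↦ (2 ≤ c ∧ 2 * c ≤ m + n) ∧ (1 ≤ 2 * c - j ∧ 2 * c - j ≤ m) ∧ (1 ≤ j ∧ j ≤ n)) (fun i j hij hP u hu ↦ ?_) (fun t ht ↦ ?_)
  · -- the free complement of the window
    by_cases hc1 : c ≤ 1
    · -- total degree `≤ 2`: `Hdg⁰ = ℚ·[Y × Z]` and Lefschetz `(1,1)`
      exact BettiUniverse.ofRatClass_crossMap_mem_algebraicClasses_of_lefschetzRange hHD hY hZ hYZ hij (Or.inl hc1) hu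
    by_cases hi2 : 2 * m < i
    · exact BettiUniverse.ofRatClass_crossMap_mem_algebraicClasses_of_lt hY hZ hij (Or.inl hi2) u
    by_cases hj2 : 2 * n < j
    · exact BettiUniverse.ofRatClass_crossMap_mem_algebraicClasses_of_lt hY hZ hij (Or.inr hj2) u
    by_cases him : m < i
    · -- `m < i ≤ 2m`: hard Lefschetz on `Y` down to the piece `H^{2m−i}(Y) ⊗ Hʲ(Z)` of degree `2(c + m − i) < 2c`
      exact BettiUniverse.ofRatClass_crossMap_mem_algebraicClasses_of_hardLefschetz_left hHD hY hZ hYZ (i₀ := 2 * m - i) (s := i - m) (c₀ := c + m - i) (by omega) (by omega) (by omega) hij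
        (fun w hw ↦ IH (c + m - i) (by omega) _ (BettiUniverse.crossMap_mem_hodgeClasses hHD hI hY hZ hYZ _ _ hw)) hu
    by_cases hjn : n < j
    · -- `n < j ≤ 2n`: hard Lefschetz on `Z` down to the piece `Hⁱ(Y) ⊗ H^{2n−j}(Z)` of degree `2(c + n − j) < 2c`
      exact BettiUniverse.ofRatClass_crossMap_mem_algebraicClasses_of_hardLefschetz_right hHD hY hZ hYZ (j₀ := 2 * n - j) (s := j - n) (c₀ := c + n - j) (by omega) (by omega) (by omega) hij
        (fun w hw ↦ IH (c + n - j) (by omega) _ (BettiUniverse.crossMap_mem_hodgeClasses hHD hI hY hZ hYZ _ _ hw)) hu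
    by_cases hi0 : i = 0
    · -- `H⁰(Y) ⊗ H^{2c}(Z)`: `HC(Z)` in degree `2c`
      subst hi0
      exact BettiUniverse.ofRatClass_crossMap_mem_algebraicClasses_of_fst_zero hHD hY hZ hij (hHCZc c) hu
    by_cases hj0 : j = 0
    · -- `H^{2c}(Y) ⊗ H⁰(Z)`: `HC(Y)` in degree `2c`
      subst hj0
      exact BettiUniverse.ofRatClass_crossMap_mem_algebraicClasses_of_snd_zero hHD hY hZ hij (hHCYc c) hu
    · -- what is left is the window
      exact absurd ⟨⟨by omega, by omega⟩, ⟨by omega, by omega⟩, ⟨by omega, by omega⟩⟩ hP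
  · -- the joint criterion on the window
    by_cases hc : 2 ≤ c ∧ 2 * c ≤ m + n
    · obtain ⟨γ, hγ, hact⟩ := hJ c hc.1 hc.2 t ht
      exact ⟨γ, hγ, fun i j a hij haj hab hP ↦ hact i j a hij haj hab (by have := hP.2.1.1; omega) (by have := hP.2.1.2; omega) hP.2.2.1 hP.2.2.2⟩
    · exact ⟨0, by rw [map_zero]; exact Submodule.zero_mem _, fun i j a hij haj hab hP ↦ absurd hP.1 hc⟩

/-- **Given `HC(Y)` and `HC(Z)`: `HC(Y × Z)` ⟺ for every `c` with `2 ≤ c`, `2c ≤ m + n`, every family of Hodge classes of the Künneth summands of `H^{2c}(Y × Z)` is JOINTLY matched on the window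
`1 ≤ i ≤ m`, `1 ≤ j ≤ n` (in its actions `H^{2n−j}(Z;ℂ) → Hⁱ(Y;ℂ)`) by one rational class with algebraic complexification** («⇒»: `γ = Σ crossMap t_{ij}`, a Hodge class, acting on each `H^{2n−j}(Z;ℂ)`
as `crossMap t_{ij}`; «⇐»: the previous theorem). [cite: VoisinHodgeI2002, §11.3.3 Thm. 11.38–11.40, Lemma 11.41 and pp. 285–287, §6.2.3 Thm. 6.25, §11.3.1 Thm. 11.30] [cite: Voisin2025, §3.2.1 (12)–(14), Prop. 3.8 and Cor. 3.9]
[cite: Deligne2000, §1] -/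
theorem BettiUniverse.hodgeConjectureFor_tensor_iff_forall_kunneth_window_family_exists_algebraic (hHD : exists_isReal_hodgeModel) (hY : IsSmoothProjective m Y) (hZ : IsSmoothProjective n Z)
    (hYZ : IsSmoothProjective d (Y ⊗ Z)) (hHCY : HodgeConjectureFor m Y) (hHCZ : HodgeConjectureFor n Z) :
    HodgeConjectureFor d (Y ⊗ Z) ↔
      ∀ c : ℕ, 2 ≤ c → 2 * c ≤ m + n → ∀ t : BettiUniverse.KunnethSrc Y Z (2 * c), (∀ ij, t ij ∈ (BettiUniverse.kunnethSummand hHD hY hZ (2 * c) ij).hodgeClasses c) →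
        ∃ γ : bettiCohomology (Y ⊗ Z) (2 * c), ofRatClass (ComplexPoints (Y ⊗ Z)) (2 * c) γ ∈ algebraicClasses (Y ⊗ Z) c ∧
          ∀ (i j a : ℕ) (hij : i + j = 2 * c) (_haj : a + j = 2 * n) (hab : a + 2 * c = i + 2 * n), 1 ≤ i → i ≤ m → 1 ≤ j → j ≤ n →
            corrAction μ hY hZ hab (ofRatClass (ComplexPoints (Y ⊗ Z)) (2 * c) γ) =
              corrAction μ hY hZ hab (ofRatClass (ComplexPoints (Y ⊗ Z)) (2 * c) (BettiUniverse.crossMap Y Z hij (t ⟨(i, j), HasAntidiagonal.mem_antidiagonal.2 hij⟩))) := by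
  have hI := hodgePQ_independent_of_hodgeModel_holds
  constructor
  · intro hHC c _ _ t ht
    have hall : ∀ v ∈ (BettiUniverse.hodge hHD hYZ (2 * c)).hodgeClasses c, ofRatClass (ComplexPoints (Y ⊗ Z)) (2 * c) v ∈ algebraicClasses (Y ⊗ Z) c :=
      fun v hv ↦ hHC.2 c _ (isRationalClass_ofRatClass _) ((BettiUniverse.mem_hodgeClasses_hodge_iff_isOfHodgeType hHD hYZ c v).1 hv)
    refine ⟨BettiUniverse.kunnethMap Y Z (2 * c) t, hall _ ((BettiUniverse.kunnethMap_mem_hodgeClasses_iff hHD hI hY hZ hYZ (2 * c) c t).2 ht), fun i j a hij _ hab _ _ _ _ ↦ ?_⟩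
    rw [BettiUniverse.kunnethMap_apply, BettiUniverse.corrAction_kunnethMap_eq μ hY hZ hij hab t]
  · intro h
    rw [hodgeConjectureFor_iff_of_hodgeModel (BettiUniverse.realHodgeModel hHD hYZ)]
    intro c
    rw [← BettiUniverse.forall_mem_hodgeClasses_hodge_iff hHD hYZ c]
    exact BettiUniverse.tensor_forall_hodgeClasses_algebraic_of_joint_corrAction_window μ hHD hY hZ hYZ hHCY hHCZ h c

end Joint

/-! ### §2 The window criterion on families of morphisms of Hodge structures -/

section JointHom

variable [HodgeTensorFacts.{0, 0}]

/-- **`HC(Y × Z)` for smooth projective `Y` (`dim m`), `Z` (`dim n`) with `HC(Y)`, `HC(Z)` IFF for every `c` with `2 ≤ c`, `2c ≤ m + n` (`n + r = c`) every WINDOW family of morphisms of `ℚ`-Hodge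
structures `φ_{ij} : H^{2n−j}(Z) → Hⁱ(Y)(r)`, `1 ≤ i ≤ m`, `1 ≤ j ≤ n`, `i + j = 2c`, is JOINTLY induced by a rational class `γ ∈ H^{2c}(Y × Z;ℚ)` with `γ ⊗ 1` algebraic** (complex orientations; §1 and
Lemma 11.41 with integer twists: the window Hodge families are exactly the window `Hom_HS` families, g31-#6 §2).  For `m = 2` these are the pairs of the seat's g31-#8, for `m = 3` the triples of g31-#9.
[cite: VoisinHodgeI2002, §7.3.1 Def. 7.22, §7.3.2, §11.3.3 Thm. 11.38–11.40, Lemma 11.41 and pp. 285–287, §6.2.3 Thm. 6.25, §11.3.1 Thm. 11.30] [cite: Voisin2025, §3.2.1 (12)–(14), Prop. 3.8 and Cor. 3.9]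
[cite: Deligne2000, §1] -/
theorem BettiUniverse.hodgeConjectureFor_tensor_iff_forall_hom_window_family_exists_algebraic (hHD : exists_isReal_hodgeModel) (hY : IsSmoothProjective m Y) (hZ : IsSmoothProjective n Z)
    (hYZ : IsSmoothProjective d (Y ⊗ Z)) (hHCY : HodgeConjectureFor m Y) (hHCZ : HodgeConjectureFor n Z) :
    HodgeConjectureFor d (Y ⊗ Z) ↔
      ∀ (c : ℕ) (_hc : 2 ≤ c) (_hcmn : 2 * c ≤ m + n)
        (Φ : ∀ (i j a : ℕ) (r : ℤ) (_hi : 1 ≤ i) (_him : i ≤ m) (_hj : 1 ≤ j) (_hjn : j ≤ n) (_hij : i + j = 2 * c) (_haj : a + j = 2 * n) (_hr : ((n : ℕ) : ℤ) + r = ((c : ℕ) : ℤ))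
          (hw : ((i : ℕ) : ℤ) - 2 * r = ((a : ℕ) : ℤ)), HodgeStructure.Hom (BettiUniverse.hodge hHD hZ a) (((BettiUniverse.hodge hHD hY i).tateTwist r).cast hw)),
        ∃ γ : bettiCohomology (Y ⊗ Z) (2 * c), ofRatClass (ComplexPoints (Y ⊗ Z)) (2 * c) γ ∈ algebraicClasses (Y ⊗ Z) c ∧
          ∀ (i j a : ℕ) (r : ℤ) (hi : 1 ≤ i) (him : i ≤ m) (hj : 1 ≤ j) (hjn : j ≤ n) (hij : i + j = 2 * c) (haj : a + j = 2 * n) (hab : a + 2 * c = i + 2 * n)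
            (hr : ((n : ℕ) : ℤ) + r = ((c : ℕ) : ℤ)) (hw : ((i : ℕ) : ℤ) - 2 * r = ((a : ℕ) : ℤ)),
            ∀ v, corrAction complexOrientationFamily hY hZ hab (ofRatClass (ComplexPoints (Y ⊗ Z)) (2 * c) γ) (ofRatClass (ComplexPoints Z) a v) =
              ofRatClass (ComplexPoints Y) i ((Φ i j a r hi him hj hjn hij haj hr hw).toLinearMap v) := by
  rw [BettiUniverse.hodgeConjectureFor_tensor_iff_forall_kunneth_window_family_exists_algebraic complexOrientationFamily hHD hY hZ hYZ hHCY hHCZ]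
  refine forall_congr' fun c ↦ forall_congr' fun _ ↦ forall_congr' fun _ ↦ ?_
  have key := BettiUniverse.joint_corrAction_iff_joint_hom_tateTwist_int hHD hY hZ (c := c) (fun j ↦ (1 ≤ 2 * c - j ∧ 2 * c - j ≤ m) ∧ (1 ≤ j ∧ j ≤ n))
  constructor
  · intro h Φ
    obtain ⟨γ, hγ, hact⟩ := key.1 (fun t ht ↦ (h t ht).imp fun γ hγ ↦ ⟨hγ.1, fun i j a hij haj hab hP ↦
        hγ.2 i j a hij haj hab (by have := hP.1.1; omega) (by have := hP.1.2; omega) hP.2.1 hP.2.2⟩)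
      (fun i j a r hij haj hr hw hP ↦ Φ i j a r (by have := hP.1.1; omega) (by have := hP.1.2; omega) hP.2.1 hP.2.2 hij haj hr hw)
    exact ⟨γ, hγ, fun i j a r hi him hj hjn hij haj hab hr hw v ↦ hact i j a r hij haj hab hr hw ⟨⟨by omega, by omega⟩, ⟨hj, hjn⟩⟩ v⟩
  · intro h t ht
    obtain ⟨γ, hγ, hact⟩ := key.2 (fun Φ ↦ (h (fun i j a r hi him hj hjn hij haj hr hw ↦ Φ i j a r hij haj hr hw ⟨⟨by omega, by omega⟩, ⟨hj, hjn⟩⟩)).imp fun γ hγ ↦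
      ⟨hγ.1, fun i j a r hij haj hab hr hw hP v ↦ hγ.2 i j a r (by have := hP.1.1; omega) (by have := hP.1.2; omega) hP.2.1 hP.2.2 hij haj hab hr hw v⟩) t ht
    exact ⟨γ, hγ, fun i j a hij haj hab hi him hj hjn ↦ hact i j a hij haj hab ⟨⟨by omega, by omega⟩, ⟨hj, hjn⟩⟩⟩

/-! ### §3 With the factors' conjectures on the right-hand side -/

/-- **`HC(Y × Z)` ⟺ `HC(Y)`, `HC(Z)` and the window criterion** — the projections `Y × Z → Y`, `Y × Z → Z` are surjective, so `HC(Y × Z) ⟹ HC(Y), HC(Z)` (Voisin I Lemma 7.28; Arapura Lemma 4.2: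
`h(Y)` is a direct summand of `h(Y × Z)`), and §2. [cite: VoisinHodgeI2002, §7.3.2 Lemma 7.28 and Remark 7.29, §11.3.3 Thm. 11.38–11.40, Lemma 11.41 and pp. 285–287] [cite: Arapura2006, §4 Lemma 4.2 (clause HC) and §1 Cor. 1.2]
[cite: Voisin2025, §3.2.1 (12)–(14), Prop. 3.8 and Cor. 3.9] [cite: Deligne2000, §1] -/
theorem BettiUniverse.hodgeConjectureFor_tensor_iff_factors_and_forall_hom_window_family_exists_algebraic (hHD : exists_isReal_hodgeModel) (hY : IsSmoothProjective m Y)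
    (hZ : IsSmoothProjective n Z) :
    HodgeConjectureFor (m + n) (Y ⊗ Z) ↔
      HodgeConjectureFor m Y ∧ HodgeConjectureFor n Z ∧
        ∀ (c : ℕ) (_hc : 2 ≤ c) (_hcmn : 2 * c ≤ m + n)
          (Φ : ∀ (i j a : ℕ) (r : ℤ) (_hi : 1 ≤ i) (_him : i ≤ m) (_hj : 1 ≤ j) (_hjn : j ≤ n) (_hij : i + j = 2 * c) (_haj : a + j = 2 * n) (_hr : ((n : ℕ) : ℤ) + r = ((c : ℕ) : ℤ))
            (hw : ((i : ℕ) : ℤ) - 2 * r = ((a : ℕ) : ℤ)), HodgeStructure.Hom (BettiUniverse.hodge hHD hZ a) (((BettiUniverse.hodge hHD hY i).tateTwist r).cast hw)),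
          ∃ γ : bettiCohomology (Y ⊗ Z) (2 * c), ofRatClass (ComplexPoints (Y ⊗ Z)) (2 * c) γ ∈ algebraicClasses (Y ⊗ Z) c ∧
            ∀ (i j a : ℕ) (r : ℤ) (hi : 1 ≤ i) (him : i ≤ m) (hj : 1 ≤ j) (hjn : j ≤ n) (hij : i + j = 2 * c) (haj : a + j = 2 * n) (hab : a + 2 * c = i + 2 * n)
              (hr : ((n : ℕ) : ℤ) + r = ((c : ℕ) : ℤ)) (hw : ((i : ℕ) : ℤ) - 2 * r = ((a : ℕ) : ℤ)),
              ∀ v, corrAction complexOrientationFamily hY hZ hab (ofRatClass (ComplexPoints (Y ⊗ Z)) (2 * c) γ) (ofRatClass (ComplexPoints Z) a v) =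
                ofRatClass (ComplexPoints Y) i ((Φ i j a r hi him hj hjn hij haj hr hw).toLinearMap v) := by
  refine ⟨fun h ↦ ?_, fun h ↦ (BettiUniverse.hodgeConjectureFor_tensor_iff_forall_hom_window_family_exists_algebraic hHD hY hZ (hY.tensor_holds hZ) h.1 h.2.1).2 h.2.2⟩
  have hHCY : HodgeConjectureFor m Y := hodgeConjectureFor_of_tensor_left hY hZ h
  have hHCZ : HodgeConjectureFor n Z := hodgeConjectureFor_of_tensor_right hY hZ h
  exact ⟨hHCY, hHCZ, (BettiUniverse.hodgeConjectureFor_tensor_iff_forall_hom_window_family_exists_algebraic hHD hY hZ (hY.tensor_holds hZ) hHCY hHCZ).1 h⟩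

end JointHom

end Literature.AlgebraicGeometry.HodgeTheory

end
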